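import Summits.AtomisticToContinuum.Crystallization.Theorems.FrustratedLawDichotomyStrainedPatchHomCertTree
import Summits.AtomisticToContinuum.Crystallization.Theorems.FrustratedLawDichotomyStrainedPatchHomLeafCheckHcp

/-!
# The bisection-tree driver instantiated for the hcp extended-Gram slice: `leafOKH`, `hcpTree_sound`

decomp-a2c hand-2 g21 (crux `AperiodicFrustratedLawGap`, stmt-AtomisticToContinuum-27623).  The generic driver `…HomCertTree.treeOK` / `treeOK_sound` with the
hcp leaf checker of `…HomLeafCheckHcp` as verdict: a certificate tree over the 13 extended Gram coordinates closes the whole ROOT box.  0 sorry; standard axioms.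
`--supports stmt-AtomisticToContinuum-27623`.
-/

namespace Summit.AtomisticToContinuum.Crystallization.Theorems.FrustratedLawDichotomyStrainedPatchHomCertTreeHcp

open scoped BigOperators RealInnerProductSpace
open Literature.Analysis.ValidatedNumerics.Numerics
open Summit.AtomisticToContinuum.Crystallization.Theorems.ChargedEnergyGapNegative (E3)
open Summit.AtomisticToContinuum.Crystallization.Theorems.FrustratedLawDichotomySchurCut (effPot w₄₅ ω₄)
open Summit.AtomisticToContinuum.Crystallization.Theorems.FrustratedLawDichotomyStrainedPatchHomSplit (latPt)
open Summit.AtomisticToContinuum.Crystallization.Theorems.FrustratedLawDichotomyStrainedPatchHomCertTree (CertTree treeOK treeOK_sound)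
open Summit.AtomisticToContinuum.Crystallization.Theorems.FrustratedLawDichotomyStrainedPatchHomLeafCheckHcp

/-- The hcp leaf checker as ONE Boolean (natively instant; in the kernel use the split facts of `leaf_soundH`). -/
def leafOKH (μ : ℤ) (c0 w : (Fin 3 × Fin 3) ⊕ (Fin 3 ⊕ Fin 1) → ℤ) : Bool :=
  termsOKH c0 w && decide (μ ≤ sumVH c0 - sumGH c0 w - sumCH c0 w)

/-- Soundness of `leafOKH`. [folklore] -/
theorem leafOKH_sound {μ : ℤ} {c0 w : (Fin 3 × Fin 3) ⊕ (Fin 3 ⊕ Fin 1) → ℤ} (h : leafOKH μ c0 w = true) (f : Fin 3 → E3) (U : E3 →L[ℝ] E3) (t : E3)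
    (hbox : ∀ k, |(Sum.elim (fun ij : Fin 3 × Fin 3 => ⟪U (f ij.1), U (f ij.2)⟫)
      (Sum.elim (fun i : Fin 3 => ⟪U (f i), U t⟫) (fun _ => ‖U t‖ ^ 2)) k) - (c0 k : ℝ) / SC| ≤ (w k : ℝ) / SC) :
    (μ : ℝ) / SC ≤ ∑ b ∈ (Fintype.piFinset fun _ : Fin 3 => Finset.Icc (-7 : ℤ) 7).filter (fun b => b ≠ 0), effPot w₄₅ ω₄ (3 / 400) ‖latPt U f b‖ +
      ∑ b ∈ (Fintype.piFinset fun _ : Fin 3 => Finset.Icc (-7 : ℤ) 7), effPot w₄₅ ω₄ (3 / 400) ‖latPt U f b + U t‖ := by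
  simp only [leafOKH, Bool.and_eq_true, decide_eq_true_eq] at h
  exact leaf_soundH h.1 rfl rfl rfl h.2 f U t hbox

/-- ★★ **SOUNDNESS OF AN hcp CERTIFICATE TREE**: `treeOK (leafOKH μ) tr c w = true` ⟹ for every `U, t` whose 13 extended Gram data (frame `f`) lie in the ROOT
box, the two-family box sum of `W₄₅` is at least `μ/SC`. [folklore] -/
theorem hcpTree_sound {μ : ℤ} {tr : CertTree ((Fin 3 × Fin 3) ⊕ (Fin 3 ⊕ Fin 1))} {c w : (Fin 3 × Fin 3) ⊕ (Fin 3 ⊕ Fin 1) → ℤ}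
    (h : treeOK (leafOKH μ) tr c w = true) (f : Fin 3 → E3) (U : E3 →L[ℝ] E3) (t : E3)
    (hbox : ∀ k, |(Sum.elim (fun ij : Fin 3 × Fin 3 => ⟪U (f ij.1), U (f ij.2)⟫)
      (Sum.elim (fun i : Fin 3 => ⟪U (f i), U t⟫) (fun _ => ‖U t‖ ^ 2)) k) - (c k : ℝ) / SC| ≤ (w k : ℝ) / SC) :
    (μ : ℝ) / SC ≤ ∑ b ∈ (Fintype.piFinset fun _ : Fin 3 => Finset.Icc (-7 : ℤ) 7).filter (fun b => b ≠ 0), effPot w₄₅ ω₄ (3 / 400) ‖latPt U f b‖ +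
      ∑ b ∈ (Fintype.piFinset fun _ : Fin 3 => Finset.Icc (-7 : ℤ) 7), effPot w₄₅ ω₄ (3 / 400) ‖latPt U f b + U t‖ :=
  treeOK_sound SC_pos (P := fun x : (Fin 3 × Fin 3) ⊕ (Fin 3 ⊕ Fin 1) → ℝ =>
      (∀ k, (Sum.elim (fun ij : Fin 3 × Fin 3 => ⟪U (f ij.1), U (f ij.2)⟫)
        (Sum.elim (fun i : Fin 3 => ⟪U (f i), U t⟫) (fun _ => ‖U t‖ ^ 2)) k) = x k) →
      (μ : ℝ) / SC ≤ ∑ b ∈ (Fintype.piFinset fun _ : Fin 3 => Finset.Icc (-7 : ℤ) 7).filter (fun b => b ≠ 0), effPot w₄₅ ω₄ (3 / 400) ‖latPt U f b‖ +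
        ∑ b ∈ (Fintype.piFinset fun _ : Fin 3 => Finset.Icc (-7 : ℤ) 7), effPot w₄₅ ω₄ (3 / 400) ‖latPt U f b + U t‖)
    (leafOKH μ) (fun c0 w0 hv x hx hG => leafOKH_sound hv f U t fun k => by rw [hG k]; exact hx k) tr c w h
    (fun k => (Sum.elim (fun ij : Fin 3 × Fin 3 => ⟪U (f ij.1), U (f ij.2)⟫)
      (Sum.elim (fun i : Fin 3 => ⟪U (f i), U t⟫) (fun _ => ‖U t‖ ^ 2)) k)) hbox (fun _ => rfl)

end Summit.AtomisticToContinuum.Crystallization.Theorems.FrustratedLawDichotomyStrainedPatchHomCertTreeHcp
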